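import Summits.QuantumFields.YangMills.Theorems.UnitScaleTiltProp7SectET3GaugeProjectorT3
import HarnessLib

/-!
# Route `UnitScaleTilt`, crux «MinimiserStabilityRegPr» (stmt-QuantumFields-19200, stub EX) ∕ (O″χ) B0 (stmt-QuantumFields-20520), node N06(d = 3), route (α) —
# DEFINITIONS FILE, LAYER 0 BRICK L0d: **PRINT'S CURVED PROPAGATORS `G = (Δ + DRD* + Q*aQ)⁻¹`, `(QGQ*)⁻¹`, `H = GQ*(QGQ*)⁻¹`, `𝔊 = G𝔓*` AT A T³ MEMBER AS
# TOTAL LETTERS** (★★OWNER ym3-torus-plan g26 ACK 32 (q2): «print's operator form IS the definition … `if h : posdef then … else 0`»), GENERIC IN THE HESSIAN LETTER `Δx`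
# (print: `Δ_π` of (3.119)∕(3.122) for `G`, `H` (3.126); `Δ₁` of (3.128)∕[Balaban1985Variational] (110) for `G₁`, `H₁` (3.129), `𝔊` (3.147) — brick L0b supplies them), **AND THEIR
# READERS IN THE EXACT LETTER TYPES OF THE EX KNIT** (`Prop7StubEXOfChartPiecesTwL.stubEX_of_chartPiecesTwL` binders `𝒢f` :127, `H₁f` :136, `h46tw`'s `H` :151)

Cell `ym-inputs` (desk `pub/ym-inputs`, INPUT-LIST.md v6 §4 row p01 = I-06 B0 DEFINER LEAD, layer 0 = the (L2)∕(L4)∕(L6) DEFINITION programme of WANTED №g25-1; memo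
`pub/ym-inputs/DEFINER-MEMO-T3.md` §2 L0d; seat `ym-inputs-p01`).  YM₃ on T³ is ladder rung R3, NOT the Clay problem; nothing here is a claim about a stub, a crux, d = 4 or the mass
gap.  `--supports stmt-QuantumFields-20520` (B0 of (O″χ) needs N06(d = 3), RULING g26-№2 (4)); count-neutral; review lane (definitions + `dif`∕`rfl` glue only — the algebraic rows
(45)∕(102)∕(129)∕(3.124) are the def-free brick L0e).

THE PRINT.  [Balaban1985BackgroundPropagators] (3.26)–(3.27) p. 395: *«Δ_a = Δ + DRD* + Q*aQ … we denote its inverse again by G, or G(U)»*; (3.122) p. 420 *«G⁻¹ defined as G⁻¹ = Δ_π +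
DRD* + Q*aQ … A = GQ*ω, QGQ*ω = B, ω = (QGQ*)⁻¹B, and finally A = GQ*(QGQ*)⁻¹B»*; (3.126) p. 420 *«HB = GQ*(QGQ*)⁻¹B»*; (3.128)–(3.129) p. 421 (`G₁`, `H₁ = G₁Q*(QG₁Q*)⁻¹`); (3.147)
p. 425 (`𝔊 = G₁𝔓*`, `Q𝔓 = 0`, `RD*𝔓 = 0`, `𝔓² = 𝔓`); Thm 3.11 p. 416: *«the operators Δ′_a, G′, (Q′G′²Q′*)⁻¹, Δ_a, G are positive definite»* (for `U` in the class (3.35)).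
[Balaban1985Variational] (45) p. 285 `LʲηQ_jHB = B`; (103) p. 293 `A′ = A₁ + H₁B`; (110)–(111) p. 294: *«We denote by G₁ an inverse operator to the operator Δ₁ + DRD* + aQ*Q … the
operator G₁𝔓* is equal to the operator 𝔊»*; (115)–(117) pp. 294–295 (the space and the norm of `𝔊`, `H₁`).

WHY ∕ HOW (located, memo §1; rulings ACK 32).  The CONSTRUCTION is lit-balaban's `B11Eq103H1Complex` (`laplaceALatticeK c R S Δ₁ Rr Q a`, `G1LatticeK hpos`, `KinvLatticeK hpos hQ`,
`H1LatticeK hpos hQ`, and the (115)-readers `H1CLM`, `B11Eq111FrakG.frakG`), which takes the positivity `hpos` ([B9] Thm 3.11 — an N06 INPUT, true on the `RegPr` class, not provable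
for an arbitrary `U₀`) and `Q` onto (`hQ`) as ARGUMENTS.  The EX binders quantify their letters over ALL backgrounds `U₀` and ask sizes only under `RegPr`; so here every letter is the
lit-balaban object on the class `PosOnto Δx U₀` («`Δx(U₀) + DRD* + Q*aQ` positive definite and `Q(U₀)` onto») and the junk value `0` off it (`dif`), at the member's DATA of bricks
L0a∕L0c: spacing `η⁻¹` (`η = eta F n K = L^{−(K−n)}`), transporters `adBg∕adBgInv`, gauge projector `R_S` (ACK 32 (q1)), and the averaging of record IN PRINT'S A-UNITS
`Qk := η • QL2` (the route's `QTwS` acts on exponents `X = ηA` and carries the factor `Lᵏ = η⁻¹` — (J2) `QTwS_one_apply`; [Balaban1985Variational] (44) `Q_j(ηA) = LʲηQ_jA + …` with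
`Lᵏη = 1` at the one-level member — which is why the EX display reads `h129 : QTw(ιH₁fB) = η⁻¹•B` and `h46tw : QTw(HY) = Y` with `H = η•H(U₀)`).

WHAT IS DEFINED (member `F : T3Family`, heights `h : n ≤ K`, weights `c₀ cB` and the constant `a` of `Q*aQ` as PARAMETERS (print: `c₀ = η³`, `cB = 1`, `a > 0` arbitrary — `H`, `𝔊` do
not depend on `a`, a THEOREM ROW of L0e (canonicity, cf. ✓`FlatCubeOperators.hOp_eq_hOp`), sizes do), a Hessian letter `Δx : ∀ U₀, BondL2K … →ₗ[ℂ] BondL2K …`, background `U₀`):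
* `Qk … U₀ := (η : ℂ) • QL2 … U₀` — print's `Q_k(U₀)` in A-units between the weighted `L²` spaces;
* **`laplaceA … Δx U₀ := laplaceALatticeK η⁻¹ (adBg U₀) (adBgInv U₀) (Δx U₀) (R_S U₀) (Qk U₀) a`** — `Δx(U₀) + D_{U₀}R_S(U₀)D*_{U₀} + Q*aQ` ((3.26)∕(3.122)∕(110));
* **`PosOnto … Δx U₀`** (a `Prop`-valued structure, fields `pos`, `onto`) — «`laplaceA Δx U₀` positive definite (`0 < re⟨x, ·x⟩`, `x ≠ 0`) ∧ `Qk U₀` onto» = the CLASS ON WHICH THE LETTERS ARE PRINT'S (Thm 3.11 + (3.19)∕`B9Eq315QTorusOnto`);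
* **`GT … Δx U₀ := if h : PosOnto then G1LatticeK h.pos else 0`** (`G`, resp. `G₁`); **`KinvT`** (`(QGQ*)⁻¹`, resp. `(QG₁Q*)⁻¹`); **`HT`** (`H = GQ*(QGQ*)⁻¹` (3.126), resp. `H₁` (3.129));
  **`frakPT`** (`𝔓` (3.147)), **`frakGT := GT ∘ 𝔓*`** (`𝔊 = G₁𝔓*` (3.153)∕(111)) — the latter two by lit-balaban's `frakPLin`∕`frakGLin` AT THE TOTAL LETTERS (no `dif` of their own);
* the READERS in the EX binder types at the member (`L := F.L`, `η := ((F.L : ℝ)⁻¹)^(K−n)` SPELLED AS IN THE BINDERS, levels `≡ K − n`, `Dc := nabla115 η (bgOfCfg F K U₀)`, fibre map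
  `frobEquiv`): **`frakGf … Δx U₀ : NegSize (F.L) η (fun _ ↦ K−n) 3 M₂(ℂ) →L[ℂ] Space115 (F.L) η (fun _ ↦ K−n) (fun _ ↦ K−n) (nabla115 η (bgOfCfg F K U₀))`** (= `𝒢f L i U₀`'s type),
  **`H1f … Δx U₀ : (PBond (F.P n) 0 → M₂(ℂ)) →L[ℂ] Space115 …`** (= `H₁f L i U₀`'s type; lit-balaban's `H1CLM` ∘ the norm-preserving bridge ✓`Prop7SectET3Transport.piIsoNegSize0`), and
  **`Hf … Δx U₀ : (PBond (F.P n) 0 → M₂(ℂ)) →ₗ[ℂ] (PBond (F.P K) 0 → M₂(ℂ))`**, `Hf := η • (toL2⁻¹ ∘ HT ∘ toL2B)` (= `h46tw`'s `H`, exponent scale).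
Glue (`dif_pos`∕`rfl`): `GT_of_pos`∕`KinvT_of_pos`∕`HT_of_pos` (on the class the letters ARE `G1LatticeK`∕`KinvLatticeK`∕`H1LatticeK`), `GT_of_not`∕`KinvT_of_not`∕`HT_of_not` (junk `0`),
`HT_eq_comp` (`H = G ∘ Q† ∘ (QGQ*)⁻¹` on the class, lit-balaban's `H1LatticeK_eq`), `laplaceA_GT` (`Δ_a G = 1` on the class), `Qk_HT` ((45) `Q(HB) = B` at the Hilbert level on the class —
lit-balaban's `Q_H1LatticeK`; the route-carrier rows `QTwS (Hf Y) = Y`, `QTwS(ιH₁fB) = η⁻¹B`, `Q𝔊 = 0` are L0e), `frakGf_apply`∕`H1f_apply`∕`Hf_apply` (unfoldings).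
HONEST SCOPE.  Definitions; no estimate; positivity and onto-ness are NOT proved (they are the class `PosOnto`, discharged on `RegPr` backgrounds by the N06 input Thm 3.11 and by the
`Q`-onto row — WANTED №g25-1); which Hessian letter makes these PRINT'S `G`∕`H` vs `G₁`∕`H₁`∕`𝔊` is brick L0b's `Δ_π`∕`Δ₁`; not a proof of any stub; nothing continuum ∕ OS ∕ mass-gap ∕ Clay.

References: T. Bałaban, CMP **99** (1985) 389–434 [Balaban1985BackgroundPropagators] ((3.26)–(3.27) p.395, Thm 3.11 p.416, (3.119)–(3.126) pp.419–420, (3.128)–(3.129) p.421, (3.147),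
(3.153) pp.425–426); CMP **102** (1985) 277–309 [Balaban1985Variational] ((44)–(46) p.285, (103) p.293, (110)–(111) p.294, (115)–(117) pp.294–295).
-/

set_option autoImplicit false

noncomputable section

open scoped InnerProductSpace ComplexConjugate Matrix.Norms.L2Operator BigOperators

namespace Summit.QuantumFields.YangMills.Theorems.Prop7SectET3CurvedPropagators

open Literature.MathematicalPhysics.QuantumFieldTheory.Balaban1983to89
open Literature.MathematicalPhysics.QuantumFieldTheory.Balaban1983to89.T3ContinuumYM3Torus
open T3SectALandauChart (eta)
open B4Sect5Torus (TSite)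
open B9SectCLatticeCarrier (Bond)
open B9Eq311L2Pairing (WL2)
open B11Eq115Space (NegSize Space115 JetSup NegSup)
open B11Eq111FrakG (nabla115 frakG frakGLin frakPLin frakG_apply)
open B11Eq103H1Complex (SiteL2K BondL2K laplaceALatticeK G1LatticeK KinvLatticeK H1LatticeK H1LatticeK_eq Q_H1LatticeK laplaceALatticeK_G1LatticeK hK_lattice
  H1CLM H1CLM_apply G1Fun QFun QadjFun DFun DstarFun funEquiv)
open Summit.QuantumFields.YangMills.Theorems.Prop7SectET3Transport (periodsT3 bondEquiv bgOfCfg piIsoNegSize0)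
open Summit.QuantumFields.YangMills.Theorems.Prop7SectET3HilbertLetters (W₂ frobEquiv adBg adBgInv toL2 toL2S toL2B QL2 DL2 DstarL2)
open Summit.QuantumFields.YangMills.Theorems.Prop7SectET3GaugeProjector (RS)

variable (F : T3Family) (n K : ℕ) (h : n ≤ K) (c₀ cB a : ℝ) [Fact (0 < c₀)] [Fact (0 < cB)]

/-! ## §1 The Hilbert-level letters: `Q_k` in A-units, `Δ_a`, the class `PosOnto`, and the TOTAL `G`, `(QGQ*)⁻¹`, `H`, `𝔓`, `𝔊` -/

/-- **PRINT'S `Q_k(U₀)` IN A-UNITS** between the weighted `L²` spaces: `η • QL2` (the route's `QTwS` differentiates the chart in the exponent `X = ηA`, hence carries `Lᵏ = η⁻¹`,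
(J2) `Prop7SymAvgTwSym.QTwS_one_apply`; print's (44) `Q_j(ηA) = LʲηQ_jA + …` with `Lᵏη = 1` at the member). [cite: Balaban1985Variational, (44)–(45) p.285] -/
def Qk (U₀ : GaugeField (F.P K) 0 (Matrix.specialUnitaryGroup (Fin 2) ℂ)) : BondL2K ℂ 3 (periodsT3 F K) c₀ W₂ →ₗ[ℂ] WL2 ℂ (fun _ : PBond (F.P n) 0 => cB) W₂ :=
  (((eta F n K : ℝ) : ℂ)) • QL2 F n K h c₀ cB U₀

variable (Δx : GaugeField (F.P K) 0 (Matrix.specialUnitaryGroup (Fin 2) ℂ) → (BondL2K ℂ 3 (periodsT3 F K) c₀ W₂ →ₗ[ℂ] BondL2K ℂ 3 (periodsT3 F K) c₀ W₂))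

/-- **`Δ_a(U₀) = Δx(U₀) + D_{U₀}R_S(U₀)D*_{U₀} + Q*aQ`** ((3.26); with `Δx := Δ_π` it is the `G⁻¹` of (3.122), with `Δx := Δ₁` the `Δ₁ + DRD* + aQ*Q` of [Balaban1985Variational] (110)) —
lit-balaban's `laplaceALatticeK` at the member's spacing, transporters, gauge projector `R_S` (brick L0c) and `Q_k` in A-units. [cite: Balaban1985BackgroundPropagators, (3.26) p.395, (3.122) p.420] -/
def laplaceA (U₀ : GaugeField (F.P K) 0 (Matrix.specialUnitaryGroup (Fin 2) ℂ)) : BondL2K ℂ 3 (periodsT3 F K) c₀ W₂ →ₗ[ℂ] BondL2K ℂ 3 (periodsT3 F K) c₀ W₂ :=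
  laplaceALatticeK (((eta F n K : ℝ) : ℂ)⁻¹) (adBg F K U₀) (adBgInv F K U₀) (Δx U₀) (RS F n K h c₀ cB U₀) (Qk F n K h c₀ cB U₀) a

/-- **THE CLASS ON WHICH THE LETTERS ARE PRINT'S**: `Δ_a(U₀)` positive definite (`0 < re⟨x, Δ_a x⟩` for `x ≠ 0` — [B9] Thm 3.11, an N06 input on the regular class (3.35), NOT proved here)
and `Q_k(U₀)` onto ((3.19) «Q′ onto», `B9Eq315QTorusOnto` in the flat case). [cite: Balaban1985BackgroundPropagators, Thm 3.11 p.416, (3.19) p.393] -/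
structure PosOnto (U₀ : GaugeField (F.P K) 0 (Matrix.specialUnitaryGroup (Fin 2) ℂ)) : Prop where
  /-- `Δ_a(U₀)` is positive definite: `0 < re⟨x, Δ_a x⟩` for `x ≠ 0` ([B9] Thm 3.11 on the regular class — displayed, not proved). -/
  pos : ∀ x : BondL2K ℂ 3 (periodsT3 F K) c₀ W₂, x ≠ 0 → 0 < RCLike.re ⟪x, laplaceA F n K h c₀ cB a Δx U₀ x⟫_ℂ
  /-- `Q_k(U₀)` is onto ((3.19) «Q′ onto»; flat case `B9Eq315QTorusOnto`). -/
  onto : Function.Surjective (Qk F n K h c₀ cB U₀)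

open Classical in
/-- **`G(U₀) = Δ_a(U₀)⁻¹` AS A TOTAL LETTER** ((3.27)∕(3.122); resp. `G₁` of (110)): lit-balaban's `G1LatticeK` on the class `PosOnto`, `0` off it.
[cite: Balaban1985BackgroundPropagators, (3.27) p.395, (3.122) p.420; Balaban1985Variational, (110) p.294] -/
def GT (U₀ : GaugeField (F.P K) 0 (Matrix.specialUnitaryGroup (Fin 2) ℂ)) : BondL2K ℂ 3 (periodsT3 F K) c₀ W₂ →ₗ[ℂ] BondL2K ℂ 3 (periodsT3 F K) c₀ W₂ :=
  if hp : PosOnto F n K h c₀ cB a Δx U₀ then G1LatticeK hp.pos else 0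

open Classical in
/-- **`(QGQ*)⁻¹` AS A TOTAL LETTER** (p. 420 «ω = (QGQ*)⁻¹B»; resp. `(QG₁Q*)⁻¹`): lit-balaban's `KinvLatticeK` on the class, `0` off it.
[cite: Balaban1985BackgroundPropagators, (3.122)–(3.126) p.420; Balaban1985Variational, (45) p.285] -/
def KinvT (U₀ : GaugeField (F.P K) 0 (Matrix.specialUnitaryGroup (Fin 2) ℂ)) : WL2 ℂ (fun _ : PBond (F.P n) 0 => cB) W₂ →ₗ[ℂ] WL2 ℂ (fun _ : PBond (F.P n) 0 => cB) W₂ :=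
  if hp : PosOnto F n K h c₀ cB a Δx U₀ then KinvLatticeK hp.pos hp.onto else 0

open Classical in
/-- **`H(U₀) = GQ*(QGQ*)⁻¹` AS A TOTAL LETTER** ((3.126); resp. `H₁ = G₁Q*(QG₁Q*)⁻¹` (3.129)∕(103)) from the block fields to the vector fields, Hilbert level: lit-balaban's `H1LatticeK` on the
class, `0` off it. [cite: Balaban1985BackgroundPropagators, (3.126) p.420, (3.129) p.421; Balaban1985Variational, (45) p.285, (103) p.293] -/
def HT (U₀ : GaugeField (F.P K) 0 (Matrix.specialUnitaryGroup (Fin 2) ℂ)) : WL2 ℂ (fun _ : PBond (F.P n) 0 => cB) W₂ →ₗ[ℂ] BondL2K ℂ 3 (periodsT3 F K) c₀ W₂ :=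
  if hp : PosOnto F n K h c₀ cB a Δx U₀ then H1LatticeK hp.pos hp.onto else 0

/-- **`𝔓 = I − GQ*(QGQ*)⁻¹Q − GDRD*` (3.147) AT THE TOTAL LETTERS** (lit-balaban's `frakPLin`; `Q* := Q†`, `D := DL2`, `R := R_S`, `D* := DstarL2`).
[cite: Balaban1985BackgroundPropagators, (3.147) p.425] -/
def frakPT (U₀ : GaugeField (F.P K) 0 (Matrix.specialUnitaryGroup (Fin 2) ℂ)) : BondL2K ℂ 3 (periodsT3 F K) c₀ W₂ →ₗ[ℂ] BondL2K ℂ 3 (periodsT3 F K) c₀ W₂ :=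
  frakPLin (GT F n K h c₀ cB a Δx U₀) (Qk F n K h c₀ cB U₀) (LinearMap.adjoint (Qk F n K h c₀ cB U₀)) (KinvT F n K h c₀ cB a Δx U₀)
    (DL2 F n K c₀ U₀) (RS F n K h c₀ cB U₀) (DstarL2 F n K c₀ U₀)

/-- **`𝔊 = G𝔓*` (3.153) = [Balaban1985Variational]'s `𝔊` of (111) AT THE TOTAL LETTERS** (lit-balaban's `frakGLin`). [cite: Balaban1985BackgroundPropagators, (3.153) p.426; Balaban1985Variational, (110)–(111) p.294] -/
def frakGT (U₀ : GaugeField (F.P K) 0 (Matrix.specialUnitaryGroup (Fin 2) ℂ)) : BondL2K ℂ 3 (periodsT3 F K) c₀ W₂ →ₗ[ℂ] BondL2K ℂ 3 (periodsT3 F K) c₀ W₂ :=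
  frakGLin (GT F n K h c₀ cB a Δx U₀) (Qk F n K h c₀ cB U₀) (LinearMap.adjoint (Qk F n K h c₀ cB U₀)) (KinvT F n K h c₀ cB a Δx U₀)
    (DL2 F n K c₀ U₀) (RS F n K h c₀ cB U₀) (DstarL2 F n K c₀ U₀)

/-! ## §2 The readers in the EX binder types (letters `𝒢f`, `H₁f`, and `h46tw`'s `H`) -/

section Readers

variable [Fact (0 < (F.L : ℝ))] [Fact (0 < ((F.L : ℝ)⁻¹) ^ (K - n))]

/-- **THE LETTER `𝒢f L i U₀` OF THE EX KNIT AT THE MEMBER**: `𝔊(U₀)` read in the continuous-linear type of (115)∕(117), `NegSize L η (K−n) 3 M₂(ℂ) →L[ℂ] Space115 L η (K−n) (K−n) (∇_{U₀})`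
(`η = L^{−(K−n)}`, `∇_{U₀} = nabla115 η (bgOfCfg F K U₀)` — SPELLED as in `Prop7StubEXOfChartPiecesTwL.stubEX_of_chartPiecesTwL`'s binder `𝒢f`), by lit-balaban's `B11Eq111FrakG.frakG` at the total
letters read on the functions along `frobEquiv`. [cite: Balaban1985Variational, (111) p.294, (115)–(117) pp.294–295] -/
def frakGf (U₀ : GaugeField (F.P K) 0 (Matrix.specialUnitaryGroup (Fin 2) ℂ)) :
    NegSize (F.L : ℝ) (((F.L : ℝ)⁻¹) ^ (K - n)) (fun _ : Bond 3 (periodsT3 F K) => K - n) 3 (Matrix (Fin 2) (Fin 2) ℂ) →L[ℂ]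
      Space115 (F.L : ℝ) (((F.L : ℝ)⁻¹) ^ (K - n)) (fun _ : Bond 3 (periodsT3 F K) => K - n) (fun _ : Bond 3 (periodsT3 F K) × Fin 3 => K - n)
        (nabla115 (((F.L : ℝ)⁻¹) ^ (K - n)) (bgOfCfg F K U₀)) :=
  frakG (fun _ : Bond 3 (periodsT3 F K) × Fin 3 => K - n) (nabla115 (((F.L : ℝ)⁻¹) ^ (K - n)) (bgOfCfg F K U₀))
    (G1Fun frobEquiv (GT F n K h c₀ cB a Δx U₀)) (QFun frobEquiv (Qk F n K h c₀ cB U₀)) (QadjFun frobEquiv (Qk F n K h c₀ cB U₀)) (KinvT F n K h c₀ cB a Δx U₀)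
    (DFun frobEquiv (DL2 F n K c₀ U₀)) (RS F n K h c₀ cB U₀) (DstarFun frobEquiv (DstarL2 F n K c₀ U₀))

/-- **THE LETTER `H₁f L i U₀` OF THE EX KNIT AT THE MEMBER**: `H₁(U₀)` (resp. `H(U₀)`) from the route's block fields `PBond (F.P n) 0 → M₂(ℂ)` into the space (115), in the binder's type —
lit-balaban's `H1CLM` at the total `HT`, precomposed with the norm-preserving bridge `piIsoNegSize0` onto the weight-0 `NegSize` synonym. [cite: Balaban1985Variational, (103) p.293, (115) p.294] -/
def H1f (U₀ : GaugeField (F.P K) 0 (Matrix.specialUnitaryGroup (Fin 2) ℂ)) :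
    (PBond (F.P n) 0 → Matrix (Fin 2) (Fin 2) ℂ) →L[ℂ]
      Space115 (F.L : ℝ) (((F.L : ℝ)⁻¹) ^ (K - n)) (fun _ : Bond 3 (periodsT3 F K) => K - n) (fun _ : Bond 3 (periodsT3 F K) × Fin 3 => K - n)
        (nabla115 (((F.L : ℝ)⁻¹) ^ (K - n)) (bgOfCfg F K U₀)) :=
  (H1CLM (lev₀ := fun _ : Bond 3 (periodsT3 F K) => K - n) frobEquiv (fun _ : Bond 3 (periodsT3 F K) × Fin 3 => K - n)
      (nabla115 (((F.L : ℝ)⁻¹) ^ (K - n)) (bgOfCfg F K U₀)) (HT F n K h c₀ cB a Δx U₀)).comp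
    (piIsoNegSize0 (Matrix (Fin 2) (Fin 2) ℂ) (F.L : ℝ) (((F.L : ℝ)⁻¹) ^ (K - n)) (fun _ : PBond (F.P n) 0 => K - n)).toLinearIsometry.toContinuousLinearMap

end Readers

/-- **THE LETTER `H` OF `h46tw` AT THE MEMBER (exponent scale)**: `H := η • (toL2⁻¹ ∘ H(U₀) ∘ toL2B)` between the route carriers — print's `H(U₀)` read back on the functions, times `η`
(«`H_route = η·H_print`», RULING g26-№10: the chart letter lives in the exponent `X = ηA`). [cite: Balaban1985Variational, (45)–(46) p.285; Balaban1985BackgroundPropagators, (3.126) p.420] -/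
def Hf (U₀ : GaugeField (F.P K) 0 (Matrix.specialUnitaryGroup (Fin 2) ℂ)) : (PBond (F.P n) 0 → Matrix (Fin 2) (Fin 2) ℂ) →ₗ[ℂ] (PBond (F.P K) 0 → Matrix (Fin 2) (Fin 2) ℂ) :=
  (((eta F n K : ℝ) : ℂ)) • ((toL2 F K c₀).symm.toLinearMap ∘ₗ HT F n K h c₀ cB a Δx U₀ ∘ₗ (toL2B F n cB).toLinearMap)

/-! ## §3 Glue: on the class the letters ARE lit-balaban's; off the class they are `0` -/

variable {F n K h c₀ cB a Δx}

/-- On the class, `G` IS lit-balaban's `G1LatticeK`. [cite: Balaban1985BackgroundPropagators, (3.27) p.395] -/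
theorem GT_of_pos {U₀ : GaugeField (F.P K) 0 (Matrix.specialUnitaryGroup (Fin 2) ℂ)} (hp : PosOnto F n K h c₀ cB a Δx U₀) :
    GT F n K h c₀ cB a Δx U₀ = G1LatticeK hp.pos := dif_pos hp

/-- Off the class, `G` is the junk value `0`. [folklore] -/
theorem GT_of_not {U₀ : GaugeField (F.P K) 0 (Matrix.specialUnitaryGroup (Fin 2) ℂ)} (hp : ¬ PosOnto F n K h c₀ cB a Δx U₀) : GT F n K h c₀ cB a Δx U₀ = 0 := dif_neg hp

/-- On the class, `(QGQ*)⁻¹` IS lit-balaban's `KinvLatticeK`. [cite: Balaban1985BackgroundPropagators, (3.126) p.420] -/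
theorem KinvT_of_pos {U₀ : GaugeField (F.P K) 0 (Matrix.specialUnitaryGroup (Fin 2) ℂ)} (hp : PosOnto F n K h c₀ cB a Δx U₀) :
    KinvT F n K h c₀ cB a Δx U₀ = KinvLatticeK hp.pos hp.onto := dif_pos hp

/-- Off the class, `(QGQ*)⁻¹` is the junk value `0`. [folklore] -/
theorem KinvT_of_not {U₀ : GaugeField (F.P K) 0 (Matrix.specialUnitaryGroup (Fin 2) ℂ)} (hp : ¬ PosOnto F n K h c₀ cB a Δx U₀) : KinvT F n K h c₀ cB a Δx U₀ = 0 := dif_neg hp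

/-- On the class, `H` IS lit-balaban's `H1LatticeK`. [cite: Balaban1985BackgroundPropagators, (3.126) p.420] -/
theorem HT_of_pos {U₀ : GaugeField (F.P K) 0 (Matrix.specialUnitaryGroup (Fin 2) ℂ)} (hp : PosOnto F n K h c₀ cB a Δx U₀) :
    HT F n K h c₀ cB a Δx U₀ = H1LatticeK hp.pos hp.onto := dif_pos hp

/-- Off the class, `H` is the junk value `0`. [folklore] -/
theorem HT_of_not {U₀ : GaugeField (F.P K) 0 (Matrix.specialUnitaryGroup (Fin 2) ℂ)} (hp : ¬ PosOnto F n K h c₀ cB a Δx U₀) : HT F n K h c₀ cB a Δx U₀ = 0 := dif_neg hp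

/-- **(3.126) ON THE CLASS: `H = G ∘ Q† ∘ (QGQ*)⁻¹`** in the total letters (lit-balaban's `H1LatticeK_eq`). [cite: Balaban1985BackgroundPropagators, (3.126) p.420] -/
theorem HT_eq_comp {U₀ : GaugeField (F.P K) 0 (Matrix.specialUnitaryGroup (Fin 2) ℂ)} (hp : PosOnto F n K h c₀ cB a Δx U₀) :
    HT F n K h c₀ cB a Δx U₀ = GT F n K h c₀ cB a Δx U₀ ∘ₗ LinearMap.adjoint (Qk F n K h c₀ cB U₀) ∘ₗ KinvT F n K h c₀ cB a Δx U₀ := by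
  rw [HT_of_pos hp, GT_of_pos hp, KinvT_of_pos hp, H1LatticeK_eq]

/-- **`Δ_a G = 1` ON THE CLASS** (p. 395 «its inverse … G»). [cite: Balaban1985BackgroundPropagators, (3.27) p.395] -/
theorem laplaceA_GT {U₀ : GaugeField (F.P K) 0 (Matrix.specialUnitaryGroup (Fin 2) ℂ)} (hp : PosOnto F n K h c₀ cB a Δx U₀) (x : BondL2K ℂ 3 (periodsT3 F K) c₀ W₂) :
    laplaceA F n K h c₀ cB a Δx U₀ (GT F n K h c₀ cB a Δx U₀ x) = x := by
  rw [GT_of_pos hp]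
  exact laplaceALatticeK_G1LatticeK hp.pos x

/-- **`QGQ*(QGQ*)⁻¹ = 1` ON THE CLASS** (lit-balaban's `hK_lattice`). [cite: Balaban1985BackgroundPropagators, (3.126) p.420] -/
theorem Qk_GT_adjoint_KinvT {U₀ : GaugeField (F.P K) 0 (Matrix.specialUnitaryGroup (Fin 2) ℂ)} (hp : PosOnto F n K h c₀ cB a Δx U₀) (y : WL2 ℂ (fun _ : PBond (F.P n) 0 => cB) W₂) :
    Qk F n K h c₀ cB U₀ (GT F n K h c₀ cB a Δx U₀ (LinearMap.adjoint (Qk F n K h c₀ cB U₀) (KinvT F n K h c₀ cB a Δx U₀ y))) = y := by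
  rw [GT_of_pos hp, KinvT_of_pos hp]
  exact hK_lattice hp.pos hp.onto y

/-- **(45) ON THE CLASS, HILBERT LEVEL: `Q_k(H B) = B`** (lit-balaban's `Q_H1LatticeK`; the route-carrier forms `QTwS (Hf Y) = Y`, `QTwS(ιH₁fB) = η⁻¹B` are brick L0e).
[cite: Balaban1985Variational, (45) p.285] -/
theorem Qk_HT {U₀ : GaugeField (F.P K) 0 (Matrix.specialUnitaryGroup (Fin 2) ℂ)} (hp : PosOnto F n K h c₀ cB a Δx U₀) (B : WL2 ℂ (fun _ : PBond (F.P n) 0 => cB) W₂) :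
    Qk F n K h c₀ cB U₀ (HT F n K h c₀ cB a Δx U₀ B) = B := by
  rw [HT_of_pos hp]
  exact Q_H1LatticeK hp.pos hp.onto B

/-- Unfolding the reader `𝒢f`: its underlying function is `𝔊 = G𝔓*` of the letters read on the functions. [cite: Balaban1985Variational, (111) p.294] -/
theorem frakGf_apply [Fact (0 < (F.L : ℝ))] [Fact (0 < ((F.L : ℝ)⁻¹) ^ (K - n))] (U₀ : GaugeField (F.P K) 0 (Matrix.specialUnitaryGroup (Fin 2) ℂ))
    (f : NegSize (F.L : ℝ) (((F.L : ℝ)⁻¹) ^ (K - n)) (fun _ : Bond 3 (periodsT3 F K) => K - n) 3 (Matrix (Fin 2) (Fin 2) ℂ)) :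
    JetSup.equiv _ _ _ (frakGf F n K h c₀ cB a Δx U₀ f) =
      frakGLin (G1Fun frobEquiv (GT F n K h c₀ cB a Δx U₀)) (QFun frobEquiv (Qk F n K h c₀ cB U₀)) (QadjFun frobEquiv (Qk F n K h c₀ cB U₀)) (KinvT F n K h c₀ cB a Δx U₀)
        (DFun frobEquiv (DL2 F n K c₀ U₀)) (RS F n K h c₀ cB U₀) (DstarFun frobEquiv (DstarL2 F n K c₀ U₀)) (NegSup.equiv _ _ f) := rfl

/-- Unfolding the reader `H₁f` at a bond: `φ` of the Hilbert-level `H` applied to `φ⁻¹ ∘ B`. [cite: Balaban1985Variational, (103) p.293] -/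
theorem H1f_apply [Fact (0 < (F.L : ℝ))] [Fact (0 < ((F.L : ℝ)⁻¹) ^ (K - n))] (U₀ : GaugeField (F.P K) 0 (Matrix.specialUnitaryGroup (Fin 2) ℂ))
    (B : PBond (F.P n) 0 → Matrix (Fin 2) (Fin 2) ℂ) (x : Bond 3 (periodsT3 F K)) :
    JetSup.equiv _ _ _ (H1f F n K h c₀ cB a Δx U₀ B) x = frobEquiv (WL2.equiv ℂ _ W₂ (HT F n K h c₀ cB a Δx U₀ (toL2B F n cB B)) x) := rfl

/-- Unfolding `h46tw`'s letter: `Hf Y = η • toL2⁻¹ (H (toL2B Y))`. [cite: Balaban1985Variational, (45) p.285] -/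
theorem Hf_apply (U₀ : GaugeField (F.P K) 0 (Matrix.specialUnitaryGroup (Fin 2) ℂ)) (Y : PBond (F.P n) 0 → Matrix (Fin 2) (Fin 2) ℂ) :
    Hf F n K h c₀ cB a Δx U₀ Y = (((eta F n K : ℝ) : ℂ)) • (toL2 F K c₀).symm (HT F n K h c₀ cB a Δx U₀ (toL2B F n cB Y)) := rfl

/-! ## §4 (v1.1, APPEND-ONLY — ERRATUM AND THE READER OF RECORD FOR `𝒢f`) -/

variable (F n K h c₀ cB a Δx)

/-- **ERRATUM (same seat, same session) + THE READER OF RECORD `frakGfR`.**  In `frakGf` (§2) the adjoint slot `QadjFun frobEquiv (Qk …)` left the fine weight `wι` of lit-balaban's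
`B11Eq103H1Complex.QadjFun` IMPLICIT; since the carrier `WL2 ℂ w W₂` does not determine `w` definitionally, instance resolution of `QadjFun`'s `[Fact (∀ x, 0 < wι x)]` fixed it to the most
recent `Fact` in scope — the (115) spacing `η = (L⁻¹)^(K−n)` — instead of the pairing weight `c₀`: so `frakGf`'s `Q*` is the adjoint for the fine weight `η`, which agrees with brick L0a's
`Q*(U₀)` (weight `c₀`) ONLY when the consumer chooses `c₀ = η`; for other `c₀` the (3.147) projector inside `frakGf` mixes two adjoints and «Q𝔊 = 0» fails for it.  `frakGf` is RETIRED
(kept, append-only; correct at `c₀ = η`).  THE READER OF RECORD is `frakGfR`, the same term with the weights PINNED `(wι := fun _ ↦ c₀) (wB := fun _ ↦ cB)`: it IS lit-balaban's reading of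
the Hilbert-level `𝔊 = frakGT` (`jet_frakGfR_eq`), in the EX binder type of `𝒢f`. [cite: Balaban1985Variational, (111) p.294, (115)–(117) pp.294–295] -/
def frakGfR [Fact (0 < (F.L : ℝ))] [Fact (0 < ((F.L : ℝ)⁻¹) ^ (K - n))] (U₀ : GaugeField (F.P K) 0 (Matrix.specialUnitaryGroup (Fin 2) ℂ)) :
    NegSize (F.L : ℝ) (((F.L : ℝ)⁻¹) ^ (K - n)) (fun _ : Bond 3 (periodsT3 F K) => K - n) 3 (Matrix (Fin 2) (Fin 2) ℂ) →L[ℂ]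
      Space115 (F.L : ℝ) (((F.L : ℝ)⁻¹) ^ (K - n)) (fun _ : Bond 3 (periodsT3 F K) => K - n) (fun _ : Bond 3 (periodsT3 F K) × Fin 3 => K - n)
        (nabla115 (((F.L : ℝ)⁻¹) ^ (K - n)) (bgOfCfg F K U₀)) :=
  frakG (fun _ : Bond 3 (periodsT3 F K) × Fin 3 => K - n) (nabla115 (((F.L : ℝ)⁻¹) ^ (K - n)) (bgOfCfg F K U₀))
    (G1Fun (w := fun _ : Bond 3 (periodsT3 F K) => c₀) frobEquiv (GT F n K h c₀ cB a Δx U₀))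
    (QFun (w := fun _ : Bond 3 (periodsT3 F K) => c₀) (wB := fun _ : PBond (F.P n) 0 => cB) frobEquiv (Qk F n K h c₀ cB U₀))
    (QadjFun (wι := fun _ : Bond 3 (periodsT3 F K) => c₀) (wB := fun _ : PBond (F.P n) 0 => cB) frobEquiv (Qk F n K h c₀ cB U₀)) (KinvT F n K h c₀ cB a Δx U₀)
    (DFun (w := fun _ : Bond 3 (periodsT3 F K) => c₀) frobEquiv (DL2 F n K c₀ U₀)) (RS F n K h c₀ cB U₀)
    (DstarFun (w := fun _ : Bond 3 (periodsT3 F K) => c₀) frobEquiv (DstarL2 F n K c₀ U₀))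

variable {F n K h c₀ cB a Δx}

/-- Unfolding the reader of record: its underlying function is `𝔓`-algebra of the letters read on the functions, weights pinned. [cite: Balaban1985Variational, (111) p.294] -/
theorem frakGfR_apply [Fact (0 < (F.L : ℝ))] [Fact (0 < ((F.L : ℝ)⁻¹) ^ (K - n))] (U₀ : GaugeField (F.P K) 0 (Matrix.specialUnitaryGroup (Fin 2) ℂ))
    (f : NegSize (F.L : ℝ) (((F.L : ℝ)⁻¹) ^ (K - n)) (fun _ : Bond 3 (periodsT3 F K) => K - n) 3 (Matrix (Fin 2) (Fin 2) ℂ)) :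
    JetSup.equiv _ _ _ (frakGfR F n K h c₀ cB a Δx U₀ f) =
      frakGLin (G1Fun (w := fun _ : Bond 3 (periodsT3 F K) => c₀) frobEquiv (GT F n K h c₀ cB a Δx U₀))
        (QFun (w := fun _ : Bond 3 (periodsT3 F K) => c₀) (wB := fun _ : PBond (F.P n) 0 => cB) frobEquiv (Qk F n K h c₀ cB U₀))
        (QadjFun (wι := fun _ : Bond 3 (periodsT3 F K) => c₀) (wB := fun _ : PBond (F.P n) 0 => cB) frobEquiv (Qk F n K h c₀ cB U₀)) (KinvT F n K h c₀ cB a Δx U₀)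
        (DFun (w := fun _ : Bond 3 (periodsT3 F K) => c₀) frobEquiv (DL2 F n K c₀ U₀)) (RS F n K h c₀ cB U₀)
        (DstarFun (w := fun _ : Bond 3 (periodsT3 F K) => c₀) frobEquiv (DstarL2 F n K c₀ U₀)) (NegSup.equiv _ _ f) := rfl

/-- **THE READER OF RECORD IS lit-balaban's READING OF `𝔊 = frakGT`**: `JetSup.equiv (frakGfR f) = funEquiv (frakGT (funEquiv⁻¹ f))` — the identity that fails for the retired `frakGf` when `c₀ ≠ η`.
[cite: Balaban1985Variational, (111) p.294] -/
theorem jet_frakGfR_eq [Fact (0 < (F.L : ℝ))] [Fact (0 < ((F.L : ℝ)⁻¹) ^ (K - n))] (U₀ : GaugeField (F.P K) 0 (Matrix.specialUnitaryGroup (Fin 2) ℂ))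
    (f : NegSize (F.L : ℝ) (((F.L : ℝ)⁻¹) ^ (K - n)) (fun _ : Bond 3 (periodsT3 F K) => K - n) 3 (Matrix (Fin 2) (Fin 2) ℂ)) :
    JetSup.equiv _ _ _ (frakGfR F n K h c₀ cB a Δx U₀ f) =
      funEquiv frobEquiv (fun _ : Bond 3 (periodsT3 F K) => c₀)
        (frakGT F n K h c₀ cB a Δx U₀ ((funEquiv frobEquiv (fun _ : Bond 3 (periodsT3 F K) => c₀)).symm (NegSup.equiv _ _ f))) := by
  rw [frakGfR_apply, B11Eq111FrakG.frakGLin_apply, frakGT, B11Eq111FrakG.frakGLin_apply]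
  simp only [G1Fun, QFun, QadjFun, DFun, DstarFun, B11Eq103H1Complex.readFun_apply, LinearMap.comp_apply, LinearEquiv.coe_coe, LinearEquiv.symm_apply_apply, map_sub]

end Summit.QuantumFields.YangMills.Theorems.Prop7SectET3CurvedPropagators

end
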